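import Summits.QuantumFields.YangMills.Theorems.ColdStartUniversalityLatticeLangevinWeightedLocalExtension
import Summits.QuantumFields.YangMills.Theorems.ColdStartUniversalityLatticeLangevinWeightedLocalCarre
import Summits.QuantumFields.YangMills.Theorems.ColdStartUniversalityLatticeLangevinWeightedGradientBound
import Summits.QuantumFields.YangMills.Theorems.ColdStartUniversalityLatticeLangevinLocalGradientBound
import HarnessLib

/-!
# The POINTWISE WEIGHTED gradient bound `|κ_t F(x') − κ_t F(x)| ≤ e^(−κ_b t)·√S·d_w(x,x')` for observables that are Lipschitz in the
# weighted distance `d_w`, with LOCAL Lipschitz data (`κ_b = 1 − (4 + 6(b²+1)/b)|β'|`)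

Seat `ym-line-csu-p1` (g43), route `ColdStartUniversality` of `Summits/QuantumFields/YangMills`, helper file (`--supports stmt-QuantumFields-24809`).
Weighted twin of G63c (`…LocalGradientBound`): the weighted Bakry–Émery gradient bound of `…WeightedGradientBound` (weight `c = 1/w` on the
carré du champ, dual to the weight `w` on the metric, `w_e ≤ b²·w_(e')` on common plaquettes) is transported to `d_w`-Lipschitz observables by
mollification (quaternionic-retraction extension, `…WeightedLocalExtension`, `…WeightedLocalCarre`):
* `wcarre_coords_eq_rho` — dictionary between the two spellings of the weighted carré du champ;
* ★★ `exists_smooth_approx_local_wcarre` — `C⁹` `g_r` with `|g_r∘coords − F| ≤ 12·L_F·√#E·r` and `Γ^(1/w)(g_r)(z) ≤ 2(G(z)/(1−2r))²` everywhere;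
* ★★ `wilson_wlipschitz_of_local_wcarre` — local weighted carré data ⇒ `|κ_t(g∘coords)(x') − κ_t(g∘coords)(x)| ≤ e^(−κ_b t)·√S/(1−2r)·d_w(x,x')`;
* ★★★ `wilson_wlocal_gradient_bound` — the weighted `(G₂)` bound for `d_w`-Lipschitz observables with local data.
THEOREMS ONLY, no definition, no sorry.  HONEST FRAMING: fixed cut-off; "uniform" = in the volume `L`; nothing `K`-uniform along the route's
scaling; `UniformColdStartMixing` (24809, ASIDE) is not restated; no crux, rung or summit statement is proved; the Yang–Mills mass gap is NOT proved.
-/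

set_option autoImplicit false

noncomputable section

namespace Summit.QuantumFields.YangMills.Theorems.ColdStartUniversality

open MeasureTheory ProbabilityTheory Matrix Complex Finset Filter Topology Set Metric
open scoped ComplexConjugate BigOperators Real NNReal Convolution
open Literature.MathematicalPhysics.QuantumFieldTheory
open Literature.MathematicalPhysics.QuantumLattice (fundamentalRep fundamentalLatticeRep continuous_fundamentalRep fundamentalRep_apply fundamentalLatticeRep_N)

variable {L : ℕ} [NeZero L]

/-- Dictionary: the weighted carré du champ written through `rebuild ∘ coords` equals its `ρ`-form. [folklore] -/
theorem wcarre_coords_eq_rho (c : Edge 3 L → ℝ) (f : (Edge 3 L × Fin 2 × Fin 2 × Bool → ℝ) → ℝ) (V : GaugeConfig 3 L (Matrix.specialUnitaryGroup (Fin 2) ℂ)) :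
    (∑ n : Edge 3 L × NoiseIdx (fundamentalLatticeRep 2).N, c n.1 * (fderiv ℝ f ((fun (V : GaugeConfig 3 L (Matrix.specialUnitaryGroup (Fin 2) ℂ)) (q : Edge 3 L × Fin (fundamentalLatticeRep 2).N × Fin (fundamentalLatticeRep 2).N × Bool) => (fun z : ℂ => if q.2.2.2 then z.im else z.re) ((fundamentalRep (Fin 2) (V q.1) : Matrix (Fin 2) (Fin 2) ℂ) q.2.1 q.2.2.1)) V) (fun q : Edge 3 L × Fin (fundamentalLatticeRep 2).N × Fin (fundamentalLatticeRep 2).N × Bool => if n.1 = q.1 then (fun z : ℂ => if q.2.2.2 then z.im else z.re) (((Real.sqrt 2 : ℂ) • ((fundamentalLatticeRep 2).lieProj (noiseDir n.2) * (fun (ee : Edge 3 L) => Matrix.of fun (i j : Fin (fundamentalLatticeRep 2).N) => (((fun (V : GaugeConfig 3 L (Matrix.specialUnitaryGroup (Fin 2) ℂ)) (q : Edge 3 L × Fin (fundamentalLatticeRep 2).N × Fin (fundamentalLatticeRep 2).N × Bool) => (fun z : ℂ => if q.2.2.2 then z.im else z.re) ((fundamentalRep (Fin 2) (V q.1) : Matrix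 (Fin 2) (Fin 2) ℂ) q.2.1 q.2.2.1)) V (ee, i, j, false) : ℝ) : ℂ) + (((fun (V : GaugeConfig 3 L (Matrix.specialUnitaryGroup (Fin 2) ℂ)) (q : Edge 3 L × Fin (fundamentalLatticeRep 2).N × Fin (fundamentalLatticeRep 2).N × Bool) => (fun z : ℂ => if q.2.2.2 then z.im else z.re) ((fundamentalRep (Fin 2) (V q.1) : Matrix (Fin 2) (Fin 2) ℂ) q.2.1 q.2.2.1)) V (ee, i, j, true) : ℝ) : ℂ) * Complex.I) q.1)) q.2.1 q.2.2.1) else 0)) ^ 2) =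
      (∑ n : Edge 3 L × NoiseIdx (fundamentalLatticeRep 2).N, c n.1 * (fderiv ℝ f ((fun (V : GaugeConfig 3 L (Matrix.specialUnitaryGroup (Fin 2) ℂ)) (q : Edge 3 L × Fin (fundamentalLatticeRep 2).N × Fin (fundamentalLatticeRep 2).N × Bool) => (fun z : ℂ => if q.2.2.2 then z.im else z.re) ((fundamentalRep (Fin 2) (V q.1) : Matrix (Fin 2) (Fin 2) ℂ) q.2.1 q.2.2.1)) V) (fun q : Edge 3 L × Fin (fundamentalLatticeRep 2).N × Fin (fundamentalLatticeRep 2).N × Bool => if n.1 = q.1 then (fun z : ℂ => if q.2.2.2 then z.im else z.re) (((Real.sqrt 2 : ℂ) • ((fundamentalLatticeRep 2).lieProj (noiseDir n.2) * (fundamentalLatticeRep 2).ρ (V q.1))) q.2.1 q.2.2.1) else 0)) ^ 2) :=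
  Finset.sum_congr rfl fun n _ => by rw [noiseVec_coords_eq_rho n V]

/-- ★★ **Smooth approximation with LOCAL control of the WEIGHTED carré du champ.**  For `F` `L_F`-Lipschitz in `ρ_L`, `0 < m ≤ w ≤ M`, `F`
`G(z)`-Lipschitz for `d_w` on each ball `{d_w(z,·) ≤ R}` (`G ≥ 0`), and `0 < r ≤ 1/4` with `√M·12√#E·r < R`, the mollification `g_r = φ_r ⋆ F̃` is `C⁹`
with `|g_r∘coords − F| ≤ 12·L_F·√#E·r` and `Γ^(1/w)(g_r)(z) = Σ_n w_(n.1)⁻¹ (W_n g_r)²(coords z) ≤ 2·(G(z)/(1−2r))²` at EVERY `z`.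
[cite: BakryGentilLedoux2014, Thm 3.2.3 / (3.2.4)] -/
theorem exists_smooth_approx_local_wcarre {F : GaugeConfig 3 L (Matrix.specialUnitaryGroup (Fin 2) ℂ) → ℝ} {Lf : ℝ} (hLf : 0 ≤ Lf)
    (hlip : ∀ Q Q', |F Q' - F Q| ≤ Lf * Real.sqrt (torusRiemannDistSq (fundamentalLatticeRep 2) (Q) (Q')))
    (w : Edge 3 L → ℝ) {m M : ℝ} (hm : 0 < m) (hwm : ∀ e, m ≤ w e) (hwM : ∀ e, w e ≤ M)
    {R : ℝ} {G : GaugeConfig 3 L (Matrix.specialUnitaryGroup (Fin 2) ℂ) → ℝ} (hG0 : ∀ z, 0 ≤ G z)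
    (hloc : ∀ z z' z'' : GaugeConfig 3 L (Matrix.specialUnitaryGroup (Fin 2) ℂ), Real.sqrt (∑ e : Edge 3 L, w e * (fundamentalLatticeRep 2).riemannDist (z e) (z' e) ^ 2) ≤ R → Real.sqrt (∑ e : Edge 3 L, w e * (fundamentalLatticeRep 2).riemannDist (z e) (z'' e) ^ 2) ≤ R → |F z'' - F z'| ≤ G z * Real.sqrt (∑ e : Edge 3 L, w e * (fundamentalLatticeRep 2).riemannDist (z' e) (z'' e) ^ 2))
    {r : ℝ} (hr0 : 0 < r) (hr : r ≤ 1 / 4) (hrR : Real.sqrt M * (12 * Real.sqrt (Fintype.card (Edge 3 L)) * r) < R) :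
    let coords : GaugeConfig 3 L (Matrix.specialUnitaryGroup (Fin 2) ℂ) → (Edge 3 L × Fin 2 × Fin 2 × Bool → ℝ) :=
      fun V q => (fun z : ℂ => if q.2.2.2 then z.im else z.re)
        ((fundamentalRep (Fin 2) (V q.1) : Matrix (Fin 2) (Fin 2) ℂ) q.2.1 q.2.2.1)
    ∃ g : (Edge 3 L × Fin 2 × Fin 2 × Bool → ℝ) → ℝ, ContDiff ℝ 9 g ∧
      (∀ P : GaugeConfig 3 L (Matrix.specialUnitaryGroup (Fin 2) ℂ), |g (coords P) - F P| ≤ Lf * (12 * Real.sqrt (Fintype.card (Edge 3 L)) * r)) ∧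
      ∀ z : GaugeConfig 3 L (Matrix.specialUnitaryGroup (Fin 2) ℂ), (∑ n : Edge 3 L × NoiseIdx (fundamentalLatticeRep 2).N, (fun e => (w e)⁻¹) n.1 * (fderiv ℝ g (coords z) (fun q : Edge 3 L × Fin (fundamentalLatticeRep 2).N × Fin (fundamentalLatticeRep 2).N × Bool => if n.1 = q.1 then (fun z : ℂ => if q.2.2.2 then z.im else z.re) (((Real.sqrt 2 : ℂ) • ((fundamentalLatticeRep 2).lieProj (noiseDir n.2) * (fundamentalLatticeRep 2).ρ (z q.1))) q.2.1 q.2.2.1) else 0)) ^ 2) ≤ 2 * (G z / (1 - 2 * r)) ^ 2 := by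
  intro coords
  let rebuild : (Edge 3 L × Fin 2 × Fin 2 × Bool → ℝ) → Edge 3 L → Matrix (Fin 2) (Fin 2) ℂ :=
    fun x e => Matrix.of fun i j : Fin 2 => ((x (e, i, j, false) : ℝ) : ℂ) + ((x (e, i, j, true) : ℝ) : ℂ) * Complex.I
  let qP : Matrix (Fin 2) (Fin 2) ℂ → Matrix (Fin 2) (Fin 2) ℂ := fun M =>
    !![(M 0 0 + conj (M 1 1)) / 2, (M 0 1 - conj (M 1 0)) / 2; -conj ((M 0 1 - conj (M 1 0)) / 2), conj ((M 0 0 + conj (M 1 1)) / 2)]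
  let retr : (Edge 3 L × Fin 2 × Fin 2 × Bool → ℝ) → GaugeConfig 3 L (Matrix.specialUnitaryGroup (Fin 2) ℂ) := fun x e =>
    if h : hsForm 2 (qP (rebuild x e)) (qP (rebuild x e)) ≠ 0 then
      ⟨(Real.sqrt 2 / Real.sqrt (hsForm 2 (qP (rebuild x e)) (qP (rebuild x e)))) • qP (rebuild x e),
        normalize_quatProj_mem_specialUnitaryGroup_two (rebuild x e) h⟩
    else 1
  let cut : (Edge 3 L × Fin 2 × Fin 2 × Bool → ℝ) → ℝ := fun x =>
    ∏ e : Edge 3 L, Real.smoothTransition (8 * hsForm 2 (qP (rebuild x e)) (qP (rebuild x e)) - 1)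
  classical
  haveI := borelSpace_config L
  have hw : ∀ e, 0 < w e := fun e => hm.trans_le (hwm e)
  have hFc : Continuous F := continuous_of_riemannLipschitz hlip
  have h12 : 0 < 1 - 2 * r := by linarith
  let Ft : (Edge 3 L × Fin 2 × Fin 2 × Bool → ℝ) → ℝ := fun x => cut x * F (retr x)
  have hFt : Continuous Ft := continuous_ext F hFc
  let φ : ContDiffBump (0 : Edge 3 L × Fin 2 × Fin 2 × Bool → ℝ) := ⟨r / 2, r, half_pos hr0, half_lt_self hr0⟩
  let g : (Edge 3 L × Fin 2 × Fin 2 × Bool → ℝ) → ℝ := φ.normed volume ⋆[ContinuousLinearMap.lsmul ℝ ℝ, volume] Ft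
  have hg : ContDiff ℝ 9 g := φ.hasCompactSupport_normed.contDiff_convolution_left _ φ.contDiff_normed hFt.locallyIntegrable
  refine ⟨g, hg, fun P => ?_, fun z => ?_⟩
  · have hP : Ft (coords P) = F P := (ext_coords F P).2
    have h1 : dist (g (coords P)) (Ft (coords P)) ≤ Lf * (12 * Real.sqrt (Fintype.card (Edge 3 L)) * r) := by
      refine φ.dist_normed_convolution_le hFt.aestronglyMeasurable fun y hy => ?_
      have hy' : ‖y - coords P‖ ≤ r := by
        have h := (Metric.mem_ball.1 hy).le
        rwa [dist_eq_norm] at h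
      have hmod : |cut y * F (retr y) - F P| ≤ Lf * (12 * Real.sqrt (Fintype.card (Edge 3 L)) * r) := ext_modulus F hLf hlip P y hr hy'
      rw [Real.dist_eq, hP]
      exact hmod
    rw [Real.dist_eq, hP] at h1
    exact h1
  · -- `Γ^(1/w)(g)(z) ≤ 2(G(z)/(1−2r) + η)²` for every `η > 0`
    have hη : ∀ η : ℝ, 0 < η → (∑ n : Edge 3 L × NoiseIdx (fundamentalLatticeRep 2).N, (fun e => (w e)⁻¹) n.1 * (fderiv ℝ g (coords z) (fun q : Edge 3 L × Fin (fundamentalLatticeRep 2).N × Fin (fundamentalLatticeRep 2).N × Bool => if n.1 = q.1 then (fun z : ℂ => if q.2.2.2 then z.im else z.re) (((Real.sqrt 2 : ℂ) • ((fundamentalLatticeRep 2).lieProj (noiseDir n.2) * (fundamentalLatticeRep 2).ρ (z q.1))) q.2.1 q.2.2.1) else 0)) ^ 2) ≤ 2 * (G z / (1 - 2 * r) + η) ^ 2 := by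
      intro η hη
      obtain ⟨δ, hδ, hloc'⟩ : ∃ δ > 0, ∀ s : Edge 3 L × Fin 2 × Fin 2 × Bool → ℝ, ‖s‖ ≤ r → ∀ Q' : GaugeConfig 3 L (Matrix.specialUnitaryGroup (Fin 2) ℂ), Real.sqrt (∑ e : Edge 3 L, w e * (fundamentalLatticeRep 2).riemannDist (z e) (Q' e) ^ 2) < δ →
            |Ft (coords Q' - s) - Ft (coords z - s)| ≤ (G z / (1 - 2 * r) + η) * Real.sqrt (∑ e : Edge 3 L, w e * (fundamentalLatticeRep 2).riemannDist (z e) (Q' e) ^ 2) :=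
        ext_shift_wlocalLipschitz_at F z w hm hwm hwM (hG0 z) (hloc z) hr hrR hη
      have hgloc : ∃ δ > 0, ∀ Q' : GaugeConfig 3 L (Matrix.specialUnitaryGroup (Fin 2) ℂ), Real.sqrt (∑ e : Edge 3 L, w e * (fundamentalLatticeRep 2).riemannDist (z e) (Q' e) ^ 2) < δ → |g (coords Q') - g (coords z)| ≤ (G z / (1 - 2 * r) + η) * Real.sqrt (∑ e : Edge 3 L, w e * (fundamentalLatticeRep 2).riemannDist (z e) (Q' e) ^ 2) := by
        refine ⟨δ, hδ, fun Q' hQ' => ?_⟩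
        exact normed_convolution_sub_le volume φ hFt (coords Q') (coords z) (B := (G z / (1 - 2 * r) + η) * Real.sqrt (∑ e : Edge 3 L, w e * (fundamentalLatticeRep 2).riemannDist (z e) (Q' e) ^ 2))
          (fun s hs => hloc' s (mem_ball_zero_iff.1 hs).le Q' hQ')
      have hpos : 0 ≤ G z / (1 - 2 * r) + η := add_nonneg (div_nonneg (hG0 z) h12.le) hη.le
      exact wcarre_le_two_mul_sq_of_local_wlipschitz z w hw (hg.differentiable (by norm_num)) hpos hgloc
    -- `η → 0`
    refine le_of_forall_pos_le_add fun ε' hε' => ?_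
    have ha0 : 0 ≤ G z / (1 - 2 * r) := div_nonneg (hG0 z) h12.le
    obtain ⟨a, ha⟩ : ∃ a : ℝ, a = G z / (1 - 2 * r) := ⟨_, rfl⟩
    rw [← ha] at hη ha0 ⊢
    have hη0 : 0 < min 1 (ε' / (2 * (2 * a + 1))) := lt_min one_pos (div_pos hε' (by positivity))
    have hη1 : min 1 (ε' / (2 * (2 * a + 1))) ≤ 1 := min_le_left _ _
    have hη2 : min 1 (ε' / (2 * (2 * a + 1))) * (2 * (2 * a + 1)) ≤ ε' := by
      have := min_le_right (1 : ℝ) (ε' / (2 * (2 * a + 1)))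
      rwa [le_div_iff₀ (by positivity)] at this
    have h := hη _ hη0
    have hexp : 2 * (a + min 1 (ε' / (2 * (2 * a + 1)))) ^ 2 =
        2 * a ^ 2 + min 1 (ε' / (2 * (2 * a + 1))) * (2 * (2 * a + min 1 (ε' / (2 * (2 * a + 1))))) := by ring
    have hmono : min 1 (ε' / (2 * (2 * a + 1))) * (2 * (2 * a + min 1 (ε' / (2 * (2 * a + 1))))) ≤
        min 1 (ε' / (2 * (2 * a + 1))) * (2 * (2 * a + 1)) := mul_le_mul_of_nonneg_left (by linarith) hη0.le
    linarith

/-- ★★ **From local WEIGHTED carré-du-champ data to a `d_w`-Lipschitz bound for `κ_t`.**  Let `b ≥ 1`, `w > 0` a link weight with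
`w_e ≤ b²·w_(e')` on common plaquettes, `κ` a realising kernel family, `g` `C⁹` with `Γ^(1/w)(g)(z) ≤ 2(G(z)/(1−2r))²` everywhere (`G` measurable,
`0 ≤ G ≤ M`, `r < 1/2`) and `∫G² dκ_t(z) ≤ S` on the ball `{d_w(x,z) ≤ d_w(x,x')}`.  Then
`|∫ g∘coords dκ_t(x') − ∫ g∘coords dκ_t(x)| ≤ e^(−(1 − (4+6(b²+1)/b)|β'|)t)·√S/(1−2r)·d_w(x,x')`. [cite: ShenZhuZhuCMP2023, Lemma 5.1 / (5.13)] -/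
theorem wilson_wlipschitz_of_local_wcarre (L : ℕ) [NeZero L] (β' b : ℝ) (hb : 1 ≤ b) (w : Edge 3 L → ℝ) (hw : ∀ e, 0 < w e)
    (hwb : ∀ (p : Plaquette 3 L) (e e' : Edge 3 L), e ∈ ({(p.1, p.2.1.1), (p.1.shift p.2.1.1, p.2.1.2), (p.1.shift p.2.1.2, p.2.1.1), (p.1, p.2.1.2)} : Finset (Edge 3 L)) → e' ∈ ({(p.1, p.2.1.1), (p.1.shift p.2.1.1, p.2.1.2), (p.1.shift p.2.1.2, p.2.1.1), (p.1, p.2.1.2)} : Finset (Edge 3 L)) → w e ≤ b ^ 2 * w e')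
    (κ : ℝ≥0 → Kernel (GaugeConfig 3 L (Matrix.specialUnitaryGroup (Fin 2) ℂ))
      (GaugeConfig 3 L (Matrix.specialUnitaryGroup (Fin 2) ℂ))) [∀ t, IsMarkovKernel (κ t)]
    (hreal : ∀ (t : ℝ≥0) (x : GaugeConfig 3 L (Matrix.specialUnitaryGroup (Fin 2) ℂ))
        (Ω : Type) [MeasurableSpace Ω] (P : Measure Ω) [IsProbabilityMeasure P]
        (W : ℝ≥0 → Ω → (Edge 3 L × NoiseIdx 2 → ℝ)) (hW : IsFlatBrownian W P)
        (U : ℝ≥0 → Ω → GaugeConfig 3 L (Matrix.specialUnitaryGroup (Fin 2) ℂ)),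
        (∀ ω, U 0 ω = x) →
        (latticeLangevinDynamics (fundamentalLatticeRep 2) β').IsSolution (fundamentalRep (Fin 2))
          hW.natFiltration P W U →
        κ t x = P.map (U t))
    {g : (Edge 3 L × Fin 2 × Fin 2 × Bool → ℝ) → ℝ} (hg : ContDiff ℝ 9 g)
    {G : GaugeConfig 3 L (Matrix.specialUnitaryGroup (Fin 2) ℂ) → ℝ} (hGm : Measurable G) {M : ℝ} (hG0 : ∀ z, 0 ≤ G z) (hGM : ∀ z, G z ≤ M)
    {r : ℝ} (hr : r < 1 / 2) (t : ℝ≥0) (x x' : GaugeConfig 3 L (Matrix.specialUnitaryGroup (Fin 2) ℂ)) {S : ℝ}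
    (hS : ∀ z : GaugeConfig 3 L (Matrix.specialUnitaryGroup (Fin 2) ℂ), Real.sqrt (∑ e : Edge 3 L, w e * (fundamentalLatticeRep 2).riemannDist (x e) (z e) ^ 2) ≤ Real.sqrt (∑ e : Edge 3 L, w e * (fundamentalLatticeRep 2).riemannDist (x e) (x' e) ^ 2) → ∫ y, G y ^ 2 ∂(κ t z) ≤ S) :
    let coords : GaugeConfig 3 L (Matrix.specialUnitaryGroup (Fin 2) ℂ) → (Edge 3 L × Fin 2 × Fin 2 × Bool → ℝ) :=
      fun V q => (fun z : ℂ => if q.2.2.2 then z.im else z.re)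
        ((fundamentalRep (Fin 2) (V q.1) : Matrix (Fin 2) (Fin 2) ℂ) q.2.1 q.2.2.1)
    (∀ z : GaugeConfig 3 L (Matrix.specialUnitaryGroup (Fin 2) ℂ), (∑ n : Edge 3 L × NoiseIdx (fundamentalLatticeRep 2).N, (fun e => (w e)⁻¹) n.1 * (fderiv ℝ g (coords z) (fun q : Edge 3 L × Fin (fundamentalLatticeRep 2).N × Fin (fundamentalLatticeRep 2).N × Bool => if n.1 = q.1 then (fun z : ℂ => if q.2.2.2 then z.im else z.re) (((Real.sqrt 2 : ℂ) • ((fundamentalLatticeRep 2).lieProj (noiseDir n.2) * (fundamentalLatticeRep 2).ρ (z q.1))) q.2.1 q.2.2.1) else 0)) ^ 2) ≤ 2 * (G z / (1 - 2 * r)) ^ 2) →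
    |∫ y, g (coords y) ∂(κ t x') - ∫ y, g (coords y) ∂(κ t x)| ≤
      Real.exp (-((1 - (4 + 6 * ((b ^ 2 + 1) / b)) * |β'|) * (t : ℝ))) * Real.sqrt S / (1 - 2 * r) * Real.sqrt (∑ e : Edge 3 L, w e * (fundamentalLatticeRep 2).riemannDist (x e) (x' e) ^ 2) := by
  intro coords hcarre
  classical
  haveI := borelSpace_config L
  have h12 : 0 < 1 - 2 * r := by linarith
  have hS0 : 0 ≤ S := by
    have h := hS x (Real.sqrt_le_sqrt (Finset.sum_le_sum fun e _ => by rw [(fundamentalLatticeRep 2).riemannDist_self, sq, mul_zero, mul_zero]; exact mul_nonneg (hw e).le (sq_nonneg _)))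
    exact le_trans (integral_nonneg fun y => sq_nonneg (G y)) h
  -- the inverse weight on the carré du champ
  let c : Edge 3 L → ℝ := fun e => (w e)⁻¹
  have hc : ∀ e, 0 < c e := fun e => inv_pos.2 (hw e)
  have hcb : ∀ (p : Plaquette 3 L) (e e' : Edge 3 L), e ∈ ({(p.1, p.2.1.1), (p.1.shift p.2.1.1, p.2.1.2), (p.1.shift p.2.1.2, p.2.1.1), (p.1, p.2.1.2)} : Finset (Edge 3 L)) → e' ∈ ({(p.1, p.2.1.1), (p.1.shift p.2.1.1, p.2.1.2), (p.1.shift p.2.1.2, p.2.1.1), (p.1, p.2.1.2)} : Finset (Edge 3 L)) → c e ≤ b ^ 2 * c e' := by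
    intro p e e' he he'
    have h1 := hwb p e' e he' he
    have hb2 : 0 < b ^ 2 := by positivity
    show (w e)⁻¹ ≤ b ^ 2 * (w e')⁻¹
    rw [← div_eq_mul_inv, le_div_iff₀ (hw e'), inv_mul_le_iff₀ (hw e)]
    linarith
  -- the weighted gradient bound of `…WeightedGradientBound` for `g`
  obtain ⟨gt, hgt, -, hrep, hgrad⟩ := wilson_wcarre_transition_le_of_whessBound L β' ((8 + 12 * ((b ^ 2 + 1) / b)) * |β'|) c (fun e => (hc e).le)
    (wilson_whessBound L β' b hb c hc hcb) κ hreal hg t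
  have hσ : ∀ z : GaugeConfig 3 L (Matrix.specialUnitaryGroup (Fin 2) ℂ), (∑ e : Edge 3 L, w e * (fundamentalLatticeRep 2).riemannDist (x e) (z e) ^ 2) ≤ (∑ e : Edge 3 L, w e * (fundamentalLatticeRep 2).riemannDist (x e) (x' e) ^ 2) →
      (∑ n : Edge 3 L × NoiseIdx (fundamentalLatticeRep 2).N, (fun e => (w e)⁻¹) n.1 * (fderiv ℝ gt (coords z) (fun q : Edge 3 L × Fin (fundamentalLatticeRep 2).N × Fin (fundamentalLatticeRep 2).N × Bool => if n.1 = q.1 then (fun z : ℂ => if q.2.2.2 then z.im else z.re) (((Real.sqrt 2 : ℂ) • ((fundamentalLatticeRep 2).lieProj (noiseDir n.2) * (fundamentalLatticeRep 2).ρ (z q.1))) q.2.1 q.2.2.1) else 0)) ^ 2) ≤ (2 / (1 - 2 * r) ^ 2 * S) / Real.exp ((2 - ((8 + 12 * ((b ^ 2 + 1) / b)) * |β'|)) * (t : ℝ)) := by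
    intro z hz
    haveI : IsProbabilityMeasure (κ t z) := IsMarkovKernel.isProbabilityMeasure z
    have h1 : Real.exp ((2 - ((8 + 12 * ((b ^ 2 + 1) / b)) * |β'|)) * (t : ℝ)) * (∑ n : Edge 3 L × NoiseIdx (fundamentalLatticeRep 2).N, c n.1 * (fderiv ℝ gt ((fun (V : GaugeConfig 3 L (Matrix.specialUnitaryGroup (Fin 2) ℂ)) (q : Edge 3 L × Fin (fundamentalLatticeRep 2).N × Fin (fundamentalLatticeRep 2).N × Bool) => (fun z : ℂ => if q.2.2.2 then z.im else z.re) ((fundamentalRep (Fin 2) (V q.1) : Matrix (Fin 2) (Fin 2) ℂ) q.2.1 q.2.2.1)) z) (fun q : Edge 3 L × Fin (fundamentalLatticeRep 2).N × Fin (fundamentalLatticeRep 2).N × Bool => if n.1 = q.1 then (fun z : ℂ => if q.2.2.2 then z.im else z.re) (((Real.sqrt 2 : ℂ) • ((fundamentalLatticeRep 2).lieProj (noiseDir n.2) * (fundamentalLatticeRep 2).ρ (z q.1))) q.2.1 q.2.2.1) else 0)) ^ 2) ≤ ∫ y, (∑ n : Edge 3 L × NoiseIdx (fundamentalLatticeRep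 2).N, c n.1 * (fderiv ℝ g ((fun (V : GaugeConfig 3 L (Matrix.specialUnitaryGroup (Fin 2) ℂ)) (q : Edge 3 L × Fin (fundamentalLatticeRep 2).N × Fin (fundamentalLatticeRep 2).N × Bool) => (fun z : ℂ => if q.2.2.2 then z.im else z.re) ((fundamentalRep (Fin 2) (V q.1) : Matrix (Fin 2) (Fin 2) ℂ) q.2.1 q.2.2.1)) y) (fun q : Edge 3 L × Fin (fundamentalLatticeRep 2).N × Fin (fundamentalLatticeRep 2).N × Bool => if n.1 = q.1 then (fun z : ℂ => if q.2.2.2 then z.im else z.re) (((Real.sqrt 2 : ℂ) • ((fundamentalLatticeRep 2).lieProj (noiseDir n.2) * (fundamentalLatticeRep 2).ρ (y q.1))) q.2.1 q.2.2.1) else 0)) ^ 2) ∂(κ t z) := by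
      calc Real.exp ((2 - ((8 + 12 * ((b ^ 2 + 1) / b)) * |β'|)) * (t : ℝ)) * (∑ n : Edge 3 L × NoiseIdx (fundamentalLatticeRep 2).N, c n.1 * (fderiv ℝ gt ((fun (V : GaugeConfig 3 L (Matrix.specialUnitaryGroup (Fin 2) ℂ)) (q : Edge 3 L × Fin (fundamentalLatticeRep 2).N × Fin (fundamentalLatticeRep 2).N × Bool) => (fun z : ℂ => if q.2.2.2 then z.im else z.re) ((fundamentalRep (Fin 2) (V q.1) : Matrix (Fin 2) (Fin 2) ℂ) q.2.1 q.2.2.1)) z) (fun q : Edge 3 L × Fin (fundamentalLatticeRep 2).N × Fin (fundamentalLatticeRep 2).N × Bool => if n.1 = q.1 then (fun z : ℂ => if q.2.2.2 then z.im else z.re) (((Real.sqrt 2 : ℂ) • ((fundamentalLatticeRep 2).lieProj (noiseDir n.2) * (fundamentalLatticeRep 2).ρ (z q.1))) q.2.1 q.2.2.1) else 0)) ^ 2)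
          = Real.exp ((2 - ((8 + 12 * ((b ^ 2 + 1) / b)) * |β'|)) * (t : ℝ)) * (∑ n : Edge 3 L × NoiseIdx (fundamentalLatticeRep 2).N, c n.1 * (fderiv ℝ gt ((fun (V : GaugeConfig 3 L (Matrix.specialUnitaryGroup (Fin 2) ℂ)) (q : Edge 3 L × Fin (fundamentalLatticeRep 2).N × Fin (fundamentalLatticeRep 2).N × Bool) => (fun z : ℂ => if q.2.2.2 then z.im else z.re) ((fundamentalRep (Fin 2) (V q.1) : Matrix (Fin 2) (Fin 2) ℂ) q.2.1 q.2.2.1)) z) (fun q : Edge 3 L × Fin (fundamentalLatticeRep 2).N × Fin (fundamentalLatticeRep 2).N × Bool => if n.1 = q.1 then (fun z : ℂ => if q.2.2.2 then z.im else z.re) (((Real.sqrt 2 : ℂ) • ((fundamentalLatticeRep 2).lieProj (noiseDir n.2) * (fun (ee : Edge 3 L) => Matrix.of fun (i j : Fin (fundamentalLatticeRep 2).N) => (((fun (V : GaugeConfig 3 L (Matrix.specialUnitaryGroup (Fin 2) ℂ)) (q : Edge 3 L × Fin (fundamentalLatticeRep 2).N × Fin (fundamentalLatticeRep 2).N ×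 Bool) => (fun z : ℂ => if q.2.2.2 then z.im else z.re) ((fundamentalRep (Fin 2) (V q.1) : Matrix (Fin 2) (Fin 2) ℂ) q.2.1 q.2.2.1)) z (ee, i, j, false) : ℝ) : ℂ) + (((fun (V : GaugeConfig 3 L (Matrix.specialUnitaryGroup (Fin 2) ℂ)) (q : Edge 3 L × Fin (fundamentalLatticeRep 2).N × Fin (fundamentalLatticeRep 2).N × Bool) => (fun z : ℂ => if q.2.2.2 then z.im else z.re) ((fundamentalRep (Fin 2) (V q.1) : Matrix (Fin 2) (Fin 2) ℂ) q.2.1 q.2.2.1)) z (ee, i, j, true) : ℝ) : ℂ) * Complex.I) q.1)) q.2.1 q.2.2.1) else 0)) ^ 2) := by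
            rw [wcarre_coords_eq_rho c gt z]
        _ ≤ ∫ y, (∑ n : Edge 3 L × NoiseIdx (fundamentalLatticeRep 2).N, c n.1 * (fderiv ℝ g ((fun (V : GaugeConfig 3 L (Matrix.specialUnitaryGroup (Fin 2) ℂ)) (q : Edge 3 L × Fin (fundamentalLatticeRep 2).N × Fin (fundamentalLatticeRep 2).N × Bool) => (fun z : ℂ => if q.2.2.2 then z.im else z.re) ((fundamentalRep (Fin 2) (V q.1) : Matrix (Fin 2) (Fin 2) ℂ) q.2.1 q.2.2.1)) y) (fun q : Edge 3 L × Fin (fundamentalLatticeRep 2).N × Fin (fundamentalLatticeRep 2).N × Bool => if n.1 = q.1 then (fun z : ℂ => if q.2.2.2 then z.im else z.re) (((Real.sqrt 2 : ℂ) • ((fundamentalLatticeRep 2).lieProj (noiseDir n.2) * (fun (ee : Edge 3 L) => Matrix.of fun (i j : Fin (fundamentalLatticeRep 2).N) => (((fun (V : GaugeConfig 3 L (Matrix.specialUnitaryGroup (Fin 2) ℂ)) (q : Edge 3 L × Fin (fundamentalLatticeRep 2).N × Fin (fundamentalLatticeRep 2).N × Bool) => (fun z : ℂ => if q.2.2.2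 then z.im else z.re) ((fundamentalRep (Fin 2) (V q.1) : Matrix (Fin 2) (Fin 2) ℂ) q.2.1 q.2.2.1)) y (ee, i, j, false) : ℝ) : ℂ) + (((fun (V : GaugeConfig 3 L (Matrix.specialUnitaryGroup (Fin 2) ℂ)) (q : Edge 3 L × Fin (fundamentalLatticeRep 2).N × Fin (fundamentalLatticeRep 2).N × Bool) => (fun z : ℂ => if q.2.2.2 then z.im else z.re) ((fundamentalRep (Fin 2) (V q.1) : Matrix (Fin 2) (Fin 2) ℂ) q.2.1 q.2.2.1)) y (ee, i, j, true) : ℝ) : ℂ) * Complex.I) q.1)) q.2.1 q.2.2.1) else 0)) ^ 2) ∂(κ t z) := hgrad z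
        _ = ∫ y, (∑ n : Edge 3 L × NoiseIdx (fundamentalLatticeRep 2).N, c n.1 * (fderiv ℝ g ((fun (V : GaugeConfig 3 L (Matrix.specialUnitaryGroup (Fin 2) ℂ)) (q : Edge 3 L × Fin (fundamentalLatticeRep 2).N × Fin (fundamentalLatticeRep 2).N × Bool) => (fun z : ℂ => if q.2.2.2 then z.im else z.re) ((fundamentalRep (Fin 2) (V q.1) : Matrix (Fin 2) (Fin 2) ℂ) q.2.1 q.2.2.1)) y) (fun q : Edge 3 L × Fin (fundamentalLatticeRep 2).N × Fin (fundamentalLatticeRep 2).N × Bool => if n.1 = q.1 then (fun z : ℂ => if q.2.2.2 then z.im else z.re) (((Real.sqrt 2 : ℂ) • ((fundamentalLatticeRep 2).lieProj (noiseDir n.2) * (fundamentalLatticeRep 2).ρ (y q.1))) q.2.1 q.2.2.1) else 0)) ^ 2) ∂(κ t z) :=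
            integral_congr_ae (ae_of_all _ fun y => wcarre_coords_eq_rho c g y)
    have hSz : ∫ y, G y ^ 2 ∂(κ t z) ≤ S := hS z (Real.sqrt_le_sqrt hz)
    have hnn : ∀ y : GaugeConfig 3 L (Matrix.specialUnitaryGroup (Fin 2) ℂ), 0 ≤ (∑ n : Edge 3 L × NoiseIdx (fundamentalLatticeRep 2).N, c n.1 * (fderiv ℝ g (coords y) (fun q : Edge 3 L × Fin (fundamentalLatticeRep 2).N × Fin (fundamentalLatticeRep 2).N × Bool => if n.1 = q.1 then (fun z : ℂ => if q.2.2.2 then z.im else z.re) (((Real.sqrt 2 : ℂ) • ((fundamentalLatticeRep 2).lieProj (noiseDir n.2) * (fundamentalLatticeRep 2).ρ (y q.1))) q.2.1 q.2.2.1) else 0)) ^ 2) := fun y => Finset.sum_nonneg fun n _ => mul_nonneg (hc n.1).le (sq_nonneg _)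
    have hGi : Integrable (fun y => 2 * (G y / (1 - 2 * r)) ^ 2) (κ t z) := by
      have hbd : ∀ y, 2 * (G y / (1 - 2 * r)) ^ 2 ∈ Set.Icc (0 : ℝ) (2 * (M / (1 - 2 * r)) ^ 2) := fun y =>
        ⟨by positivity, by
          have := div_le_div_of_nonneg_right (hGM y) h12.le
          have h0 : 0 ≤ G y / (1 - 2 * r) := div_nonneg (hG0 y) h12.le
          nlinarith⟩
      have hmeas : Measurable fun y => 2 * (G y / (1 - 2 * r)) ^ 2 := ((hGm.div_const _).pow_const 2).const_mul 2
      exact (memLp_of_bounded (ae_of_all _ hbd) hmeas.aestronglyMeasurable 1).integrable le_rfl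
    have h2 : ∫ y, (∑ n : Edge 3 L × NoiseIdx (fundamentalLatticeRep 2).N, c n.1 * (fderiv ℝ g (coords y) (fun q : Edge 3 L × Fin (fundamentalLatticeRep 2).N × Fin (fundamentalLatticeRep 2).N × Bool => if n.1 = q.1 then (fun z : ℂ => if q.2.2.2 then z.im else z.re) (((Real.sqrt 2 : ℂ) • ((fundamentalLatticeRep 2).lieProj (noiseDir n.2) * (fundamentalLatticeRep 2).ρ (y q.1))) q.2.1 q.2.2.1) else 0)) ^ 2) ∂(κ t z) ≤ ∫ y, 2 * (G y / (1 - 2 * r)) ^ 2 ∂(κ t z) :=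
      integral_mono_of_nonneg (ae_of_all _ hnn) hGi (ae_of_all _ hcarre)
    have h3 : ∫ y, 2 * (G y / (1 - 2 * r)) ^ 2 ∂(κ t z) = 2 / (1 - 2 * r) ^ 2 * ∫ y, G y ^ 2 ∂(κ t z) := by
      rw [← integral_const_mul]
      refine integral_congr_ae (ae_of_all _ fun y => ?_)
      show 2 * (G y / (1 - 2 * r)) ^ 2 = 2 / (1 - 2 * r) ^ 2 * G y ^ 2
      field_simp
    have h4 : ∫ y, 2 * (G y / (1 - 2 * r)) ^ 2 ∂(κ t z) ≤ 2 / (1 - 2 * r) ^ 2 * S := by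
      rw [h3]; exact mul_le_mul_of_nonneg_left hSz (by positivity)
    have hexp0 : 0 < Real.exp ((2 - ((8 + 12 * ((b ^ 2 + 1) / b)) * |β'|)) * (t : ℝ)) := Real.exp_pos _
    rw [le_div_iff₀ hexp0, mul_comm]
    exact h1.trans (h2.trans h4)
  -- the localised weighted G42 for `gt`
  have hgt_lip : |gt (coords x') - gt (coords x)| ≤ Real.sqrt ((2 / (1 - 2 * r) ^ 2 * S) / Real.exp ((2 - ((8 + 12 * ((b ^ 2 + 1) / b)) * |β'|)) * (t : ℝ)) / 2) * Real.sqrt (∑ e : Edge 3 L, w e * (fundamentalLatticeRep 2).riemannDist (x e) (x' e) ^ 2) :=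
    abs_sub_le_of_wcarre_le_on_ball x x' w hw (hgt.differentiable (by norm_num)) hσ
  have hsqrt : Real.sqrt ((2 / (1 - 2 * r) ^ 2 * S) / Real.exp ((2 - ((8 + 12 * ((b ^ 2 + 1) / b)) * |β'|)) * (t : ℝ)) / 2) =
      Real.exp (-((1 - (4 + 6 * ((b ^ 2 + 1) / b)) * |β'|) * (t : ℝ))) * Real.sqrt S / (1 - 2 * r) := by
    have he : Real.exp ((2 - ((8 + 12 * ((b ^ 2 + 1) / b)) * |β'|)) * (t : ℝ)) = (Real.exp ((1 - (4 + 6 * ((b ^ 2 + 1) / b)) * |β'|) * (t : ℝ))) ^ 2 := by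
      rw [← Real.exp_nat_mul]; congr 1; push_cast; ring
    have hE : 0 < Real.exp ((1 - (4 + 6 * ((b ^ 2 + 1) / b)) * |β'|) * (t : ℝ)) := Real.exp_pos _
    rw [he, show (2 / (1 - 2 * r) ^ 2 * S) / (Real.exp ((1 - (4 + 6 * ((b ^ 2 + 1) / b)) * |β'|) * (t : ℝ))) ^ 2 / 2 =
      (1 / ((1 - 2 * r) * Real.exp ((1 - (4 + 6 * ((b ^ 2 + 1) / b)) * |β'|) * (t : ℝ)))) ^ 2 * S by field_simp]
    rw [Real.sqrt_mul (sq_nonneg _), Real.sqrt_sq (by positivity), Real.exp_neg]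
    field_simp
  rw [hrep x', hrep x, ← hsqrt]
  exact hgt_lip

/-- ★★★ **Pointwise weighted gradient bound for `d_w`-Lipschitz observables, with local Lipschitz data.**  Let `b ≥ 1`, `0 < m ≤ w ≤ M` a link
weight with `w_e ≤ b²·w_(e')` on common plaquettes, `κ` a realising kernel family, `F : SU(2)^E → ℝ` `L_F`-Lipschitz for `ρ_L`, and `G` measurable
with `0 ≤ G ≤ M_G` such that `F` is `G(z)`-Lipschitz for `d_w` on every ball `{d_w(z,·) ≤ R}` (a fixed `R > 0`).  If `∫ G² dκ_t(z) ≤ S` for all `z` with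
`d_w(x,z) ≤ d_w(x,x')`, then `|∫F dκ_t(x') − ∫F dκ_t(x)| ≤ e^(−(1 − (4+6(b²+1)/b)|β'|)·t)·√S·d_w(x,x')` — the weighted form of Bakry–Émery's `(G₂)`,
the gradient estimate behind Shen–Zhu–Zhu's weighted coupling. [cite: ShenZhuZhuCMP2023, Lemma 5.1 / (5.13)] -/
theorem wilson_wlocal_gradient_bound (L : ℕ) [NeZero L] (β' b : ℝ) (hb : 1 ≤ b) (w : Edge 3 L → ℝ) {m M : ℝ} (hm : 0 < m)
    (hwm : ∀ e, m ≤ w e) (hwM : ∀ e, w e ≤ M)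
    (hwb : ∀ (p : Plaquette 3 L) (e e' : Edge 3 L), e ∈ ({(p.1, p.2.1.1), (p.1.shift p.2.1.1, p.2.1.2), (p.1.shift p.2.1.2, p.2.1.1), (p.1, p.2.1.2)} : Finset (Edge 3 L)) → e' ∈ ({(p.1, p.2.1.1), (p.1.shift p.2.1.1, p.2.1.2), (p.1.shift p.2.1.2, p.2.1.1), (p.1, p.2.1.2)} : Finset (Edge 3 L)) → w e ≤ b ^ 2 * w e')
    (κ : ℝ≥0 → Kernel (GaugeConfig 3 L (Matrix.specialUnitaryGroup (Fin 2) ℂ))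
      (GaugeConfig 3 L (Matrix.specialUnitaryGroup (Fin 2) ℂ))) [∀ t, IsMarkovKernel (κ t)]
    (hreal : ∀ (t : ℝ≥0) (x : GaugeConfig 3 L (Matrix.specialUnitaryGroup (Fin 2) ℂ))
        (Ω : Type) [MeasurableSpace Ω] (P : Measure Ω) [IsProbabilityMeasure P]
        (W : ℝ≥0 → Ω → (Edge 3 L × NoiseIdx 2 → ℝ)) (hW : IsFlatBrownian W P)
        (U : ℝ≥0 → Ω → GaugeConfig 3 L (Matrix.specialUnitaryGroup (Fin 2) ℂ)),
        (∀ ω, U 0 ω = x) →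
        (latticeLangevinDynamics (fundamentalLatticeRep 2) β').IsSolution (fundamentalRep (Fin 2))
          hW.natFiltration P W U →
        κ t x = P.map (U t))
    {F : GaugeConfig 3 L (Matrix.specialUnitaryGroup (Fin 2) ℂ) → ℝ} {Lf : ℝ} (hLf : 0 ≤ Lf) (hlip : ∀ Q Q', |F Q' - F Q| ≤ Lf * Real.sqrt (torusRiemannDistSq (fundamentalLatticeRep 2) (Q) (Q')))
    {R : ℝ} (hR : 0 < R) {G : GaugeConfig 3 L (Matrix.specialUnitaryGroup (Fin 2) ℂ) → ℝ} (hGm : Measurable G) {MG : ℝ} (hG0 : ∀ z, 0 ≤ G z) (hGM : ∀ z, G z ≤ MG)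
    (hloc : ∀ z z' z'' : GaugeConfig 3 L (Matrix.specialUnitaryGroup (Fin 2) ℂ), Real.sqrt (∑ e : Edge 3 L, w e * (fundamentalLatticeRep 2).riemannDist (z e) (z' e) ^ 2) ≤ R → Real.sqrt (∑ e : Edge 3 L, w e * (fundamentalLatticeRep 2).riemannDist (z e) (z'' e) ^ 2) ≤ R → |F z'' - F z'| ≤ G z * Real.sqrt (∑ e : Edge 3 L, w e * (fundamentalLatticeRep 2).riemannDist (z' e) (z'' e) ^ 2))
    (t : ℝ≥0) (x x' : GaugeConfig 3 L (Matrix.specialUnitaryGroup (Fin 2) ℂ)) {S : ℝ}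
    (hS : ∀ z : GaugeConfig 3 L (Matrix.specialUnitaryGroup (Fin 2) ℂ), Real.sqrt (∑ e : Edge 3 L, w e * (fundamentalLatticeRep 2).riemannDist (x e) (z e) ^ 2) ≤ Real.sqrt (∑ e : Edge 3 L, w e * (fundamentalLatticeRep 2).riemannDist (x e) (x' e) ^ 2) → ∫ y, G y ^ 2 ∂(κ t z) ≤ S) :
    |∫ y, F y ∂(κ t x') - ∫ y, F y ∂(κ t x)| ≤ Real.exp (-((1 - (4 + 6 * ((b ^ 2 + 1) / b)) * |β'|) * (t : ℝ))) * Real.sqrt S * Real.sqrt (∑ e : Edge 3 L, w e * (fundamentalLatticeRep 2).riemannDist (x e) (x' e) ^ 2) := by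
  let coords : GaugeConfig 3 L (Matrix.specialUnitaryGroup (Fin 2) ℂ) → (Edge 3 L × Fin 2 × Fin 2 × Bool → ℝ) :=
    fun V q => (fun z : ℂ => if q.2.2.2 then z.im else z.re) ((fundamentalRep (Fin 2) (V q.1) : Matrix (Fin 2) (Fin 2) ℂ) q.2.1 q.2.2.1)
  classical
  haveI := borelSpace_config L
  have hw : ∀ e, 0 < w e := fun e => hm.trans_le (hwm e)
  have hFc : Continuous F := continuous_of_riemannLipschitz hlip
  have hco : Continuous coords := continuous_coords (L := L)
  obtain ⟨E, hEdef⟩ : ∃ E : ℝ, E = Real.sqrt (Fintype.card (Edge 3 L)) := ⟨_, rfl⟩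
  have hE0 : 0 ≤ E := by rw [hEdef]; exact Real.sqrt_nonneg _
  have hM0 : 0 ≤ Real.sqrt M := Real.sqrt_nonneg _
  obtain ⟨D, hDdef⟩ : ∃ D : ℝ, D = Real.sqrt (∑ e : Edge 3 L, w e * (fundamentalLatticeRep 2).riemannDist (x e) (x' e) ^ 2) := ⟨_, rfl⟩
  have hD0 : 0 ≤ D := by rw [hDdef]; exact Real.sqrt_nonneg _
  obtain ⟨c, hcdef⟩ : ∃ c : ℝ, c = Real.exp (-((1 - (4 + 6 * ((b ^ 2 + 1) / b)) * |β'|) * (t : ℝ))) := ⟨_, rfl⟩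
  have hc0 : 0 < c := by rw [hcdef]; exact Real.exp_pos _
  have hS0 : 0 ≤ S := by
    have h := hS x (Real.sqrt_le_sqrt (Finset.sum_le_sum fun e _ => by rw [(fundamentalLatticeRep 2).riemannDist_self, sq, mul_zero, mul_zero]; exact mul_nonneg (hw e).le (sq_nonneg _)))
    exact le_trans (integral_nonneg fun y => sq_nonneg (G y)) h
  rw [← hDdef, ← hcdef]
  refine le_of_forall_pos_le_add fun ε hε => ?_
  -- choice of the mollification radius
  obtain ⟨B, hBdef⟩ : ∃ B : ℝ, B = 24 * Lf * E + 4 * (c * Real.sqrt S * D) + 1 := ⟨_, rfl⟩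
  have hB : 0 < B := by rw [hBdef]; positivity
  obtain ⟨r, hrdef⟩ : ∃ r : ℝ, r = min (min (1 / 4) (R / (24 * Real.sqrt M * E + 1))) (ε / B) := ⟨_, rfl⟩
  have hr0 : 0 < r := by rw [hrdef]; exact lt_min (lt_min (by norm_num) (div_pos hR (by positivity))) (div_pos hε hB)
  have hr : r ≤ 1 / 4 := by rw [hrdef]; exact (min_le_left _ _).trans (min_le_left _ _)
  have hrR : Real.sqrt M * (12 * Real.sqrt (Fintype.card (Edge 3 L)) * r) < R := by
    rw [← hEdef]
    have h1 : r ≤ R / (24 * Real.sqrt M * E + 1) := by rw [hrdef]; exact (min_le_left _ _).trans (min_le_right _ _)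
    have h2 : 12 * Real.sqrt M * E * r ≤ 12 * Real.sqrt M * E * (R / (24 * Real.sqrt M * E + 1)) := mul_le_mul_of_nonneg_left h1 (by positivity)
    have h3 : 12 * Real.sqrt M * E * (R / (24 * Real.sqrt M * E + 1)) < R := by
      have hP : 0 ≤ Real.sqrt M * E * R := by positivity
      rw [mul_div_assoc', div_lt_iff₀ (by positivity)]; nlinarith [hP]
    calc Real.sqrt M * (12 * E * r) = 12 * Real.sqrt M * E * r := by ring
      _ ≤ 12 * Real.sqrt M * E * (R / (24 * Real.sqrt M * E + 1)) := h2
      _ < R := h3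
  have hrB : r * B ≤ ε := by
    have : r ≤ ε / B := by rw [hrdef]; exact min_le_right _ _
    rwa [le_div_iff₀ hB] at this
  have h12 : 0 < 1 - 2 * r := by linarith
  -- the smooth approximation with local weighted carré control, and its Lipschitz bound under `κ_t`
  obtain ⟨g, hg, happrox', hcarre⟩ := exists_smooth_approx_local_wcarre (L := L) hLf hlip w hm hwm hwM hG0 hloc hr0 hr hrR
  have happrox : ∀ P : GaugeConfig 3 L (Matrix.specialUnitaryGroup (Fin 2) ℂ), |g (coords P) - F P| ≤ Lf * (12 * E * r) := by
    rw [hEdef]; exact happrox'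
  have hglip : |∫ y, g (coords y) ∂(κ t x') - ∫ y, g (coords y) ∂(κ t x)| ≤ c * Real.sqrt S / (1 - 2 * r) * D := by
    rw [hcdef, hDdef]
    exact wilson_wlipschitz_of_local_wcarre L β' b hb w hw hwb κ hreal hg hGm hG0 hGM (by linarith) t x x' hS hcarre
  -- `|∫F dκ − ∫g∘coords dκ| ≤ 12·L_F·E·r` at both points
  have hint : ∀ P : GaugeConfig 3 L (Matrix.specialUnitaryGroup (Fin 2) ℂ), |∫ y, F y ∂(κ t P) - ∫ y, g (coords y) ∂(κ t P)| ≤ Lf * (12 * E * r) := by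
    intro P
    have hFi : Integrable F (κ t P) := hFc.integrable_of_hasCompactSupport (HasCompactSupport.of_compactSpace F)
    have hgi : Integrable (fun y => g (coords y)) (κ t P) :=
      (hg.continuous.comp hco).integrable_of_hasCompactSupport (HasCompactSupport.of_compactSpace _)
    rw [← integral_sub hFi hgi]
    calc |∫ y, (F y - g (coords y)) ∂(κ t P)| ≤ ∫ y, |F y - g (coords y)| ∂(κ t P) := abs_integral_le_integral_abs
      _ ≤ ∫ _y, Lf * (12 * E * r) ∂(κ t P) :=
          integral_mono_of_nonneg (ae_of_all _ fun _ => abs_nonneg _) (integrable_const _)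
            (ae_of_all _ fun y => (abs_sub_comm _ _).trans_le (happrox y))
      _ = Lf * (12 * E * r) := by rw [integral_const, probReal_univ, one_smul]
  have h1 := hint x
  have h2 := hint x'
  have h4 := abs_sub_le (∫ y, F y ∂(κ t x')) (∫ y, g (coords y) ∂(κ t x')) (∫ y, F y ∂(κ t x))
  have h5 := abs_sub_le (∫ y, g (coords y) ∂(κ t x')) (∫ y, g (coords y) ∂(κ t x)) (∫ y, F y ∂(κ t x))
  have h6 : |∫ y, g (coords y) ∂(κ t x) - ∫ y, F y ∂(κ t x)| ≤ Lf * (12 * E * r) := by rw [abs_sub_comm]; exact h1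
  -- `1/(1−2r) ≤ 1 + 4r`
  have hfrac : c * Real.sqrt S / (1 - 2 * r) ≤ c * Real.sqrt S * (1 + 4 * r) := by
    rw [div_le_iff₀ h12]
    have : 1 ≤ (1 + 4 * r) * (1 - 2 * r) := by nlinarith
    have hcs : 0 ≤ c * Real.sqrt S := by positivity
    nlinarith
  calc |∫ y, F y ∂(κ t x') - ∫ y, F y ∂(κ t x)| ≤ Lf * (12 * E * r) + (c * Real.sqrt S / (1 - 2 * r) * D + Lf * (12 * E * r)) := by linarith
    _ ≤ Lf * (12 * E * r) + (c * Real.sqrt S * (1 + 4 * r) * D + Lf * (12 * E * r)) := by gcongr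
    _ = c * Real.sqrt S * D + r * (24 * Lf * E + 4 * (c * Real.sqrt S * D)) := by ring
    _ ≤ c * Real.sqrt S * D + r * B := by
        have : 24 * Lf * E + 4 * (c * Real.sqrt S * D) ≤ B := by rw [hBdef]; linarith
        nlinarith
    _ ≤ c * Real.sqrt S * D + ε := by linarith

end Summit.QuantumFields.YangMills.Theorems.ColdStartUniversality
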